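import Summits.SmoothPoincare4.SmoothPoincare4.Theorems.EntropyRungCompactGapOfChangGurskyYangForms
import Summits.SmoothPoincare4.SmoothPoincare4.Theorems.EntropyRungCompactShrinkerGapJensenVolumeBound
import Summits.SmoothPoincare4.SmoothPoincare4.Theorems.EntropyRungCompactShrinkerGapScalarCurvatureSqLe
import Summits.SmoothPoincare4.SmoothPoincare4.Theorems.EntropyRungCompactShrinkerGapVarianceIntegralDefect
import Summits.SmoothPoincare4.SmoothPoincare4.Theorems.EntropyRungCompactShrinkerGapCrzSharpBound
import HarnessLib

/-!
# Route EntropyRung — the glue item `CompactGapOfChangGurskyYang` from the pointwise bound `R ≤ 3`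

Third registered typing of the open content of item stmt-SmoothPoincare4-14743
(`CompactGapOfChangGurskyYang : ChangGurskyYang → CompactShrinkerGap`; companion of
`EntropyRungCompactGapOfChangGurskyYangForms.lean`): the item follows from the pointwise bound `R ≤ 3` for
dense normalised gradient shrinkers on closed homotopy 4-spheres (hypothesis `hR3`, byte-for-byte the registered
stub `stub_scalarLeThree` of line `cgy-variance-pivot` of crux stmt-SmoothPoincare4-10870) together with the
Chern–Gauss–Bonnet formula as the named-fact hypothesis `hCGB`:

`R ≤ 3 ⇒ f ≤ 3` (Fermat at a maximum of `f`, `R + |∇f|² = f`; `forall_potential_le_of_forall_scalarCurvature_le`)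
`⇒ ∫(R − 2)² dV < 2·Vol − 96π²` (`varianceBudget_of_potential_le_three`: the LANDED Cheng–Ribeiro–Zhou sub-line —
trace Cauchy–Schwarz `R² ≤ 4|Ric|²` (`stub_scalarCurvature_sq_le`, p77783), the defect identity
`D = ∫(R − 2|Ric|²)(e^{c−f} − 1)` (`stub_variance_eq_integral_defect`, p80736), CRZ sharp `D ≤ ½(e³Z − V)`
(`stub_crzSharpBound_of_identities`, p82799) — with Jensen `Z ≤ e^{-2}V` (`stub_jensenVolumeBound`, p71839) and
the density `Z > 32π²√π e^{-3/2}`, arithmetic `varianceBudget_arith`: `(5 − e)√π e^{1/2} > 6`)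
`⇒` the item (`compactGapOfChangGurskyYang_of_varianceBudget`: CGB turns the variance budget into the Weyl
budget, CGY returns the diffeomorphism).

References: X. Cheng, E. Ribeiro, D. Zhou, arXiv:2203.14916, Thm. 1, §3.2, Rem. 1–2 [ChengRibeiroZhou2022];
S.-Y. A. Chang, M. J. Gursky, P. C. Yang, Publ. Math. IHÉS 98 (2003), Thm. A [ChangGurskyYang2003];
H.-D. Cao, R. Hamilton, T. Ilmanen, arXiv:math/0404165, §4 [CaoHamiltonIlmanen2004].
-/

-- the registered namespace `Summit.SmoothPoincare4.SmoothPoincare4.Theorems` repeats a component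
set_option linter.dupNamespace false

noncomputable section

open MeasureTheory Set
open scoped Manifold ContDiff ENNReal ContinuousMap

namespace Summit.SmoothPoincare4.SmoothPoincare4.Theorems

open Summit.SmoothPoincare4.SmoothPoincare4.Theses.EntropyRung
open Literature.Geometry.Lorentzian (riemannianMeasure riemannianVolume_lt_top_of_isCompact_holds)

/-! ## The Cheng–Ribeiro–Zhou route: `R ≤ 3 ⇒ f ≤ 3 ⇒` the variance budget -/

/-- **Arithmetic core of the Cheng–Ribeiro–Zhou route** (pure reals): from `Z₀ = 32π²√π e^{-3/2} < Z`, Jensen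
`Z ≤ e^{-2}V` and the CRZ bound at `c = 3`, `D ≤ ½(e³Z − V)`, conclude `D < 2V − 96π²`: indeed `e³Z ≤ eV`,
`V > e²Z₀ = 32π²√π e^{1/2}`, and `(5 − e)√π e^{1/2} > 6` (numerically `6.667`), so `e³Z + 192π² < 5V`.
Adapted from the registered skeleton `Cruxes/CompactShrinkerGap/Lines/cgy_variance_pivot.lean` (v9). [folklore] -/
theorem varianceBudget_arith {V Z D : ℝ}
    (hZ₀ : 32 * Real.pi ^ 2 * Real.sqrt Real.pi * Real.exp (-(3 : ℝ) / 2) < Z)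
    (hJ : Z ≤ Real.exp (-2) * V)
    (hD : D ≤ 1 / 2 * (Real.exp 3 * Z - V)) :
    D < 2 * V - 96 * Real.pi ^ 2 := by
  have hπ := Real.pi_pos
  -- exponential bookkeeping
  have E₁ : Real.exp 2 * Real.exp (-2) = 1 := by rw [← Real.exp_add]; norm_num
  have E₂ : Real.exp 3 = Real.exp 1 * Real.exp 2 := by rw [← Real.exp_add]; norm_num
  have E₃ : Real.exp (-(3 : ℝ) / 2) * Real.exp 2 = Real.exp (1 / 2) := by
    rw [← Real.exp_add]; norm_num
  -- `e²Z ≤ V`, `e³Z ≤ eV`, `V > 32π²√π e^{1/2}`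
  have hV : Real.exp 2 * Z ≤ V := by
    calc Real.exp 2 * Z ≤ Real.exp 2 * (Real.exp (-2) * V) :=
          mul_le_mul_of_nonneg_left hJ (Real.exp_pos 2).le
      _ = V := by rw [← mul_assoc, E₁, one_mul]
  have h3Z : Real.exp 3 * Z ≤ Real.exp 1 * V := by
    rw [E₂, mul_assoc]
    exact mul_le_mul_of_nonneg_left hV (Real.exp_pos 1).le
  have hV₀ : 32 * Real.pi ^ 2 * Real.sqrt Real.pi * Real.exp (1 / 2) < V := by
    calc 32 * Real.pi ^ 2 * Real.sqrt Real.pi * Real.exp (1 / 2)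
        = (32 * Real.pi ^ 2 * Real.sqrt Real.pi * Real.exp (-(3 : ℝ) / 2)) * Real.exp 2 := by
          rw [← E₃]; ring
      _ < Z * Real.exp 2 := mul_lt_mul_of_pos_right hZ₀ (Real.exp_pos 2)
      _ ≤ V := by rw [mul_comm]; exact hV
  -- numerics: `(5 − e) · √π · e^{1/2} > 6`
  have hs : (1.77245 : ℝ) < Real.sqrt Real.pi := by
    rw [Real.lt_sqrt (by norm_num)]
    have := Real.pi_gt_d6
    nlinarith
  have ht : (1.6487 : ℝ) < Real.exp (1 / 2) := by
    have h : (1.6487 : ℝ) ^ 2 < Real.exp (1 / 2) ^ 2 := by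
      rw [← Real.exp_nat_mul]
      norm_num
      have := Real.exp_one_gt_d9
      linarith
    exact lt_of_pow_lt_pow_left₀ 2 (Real.exp_pos _).le h
  have ht' : Real.exp (1 / 2) < (1.6488 : ℝ) := by
    have h : Real.exp (1 / 2) ^ 2 < (1.6488 : ℝ) ^ 2 := by
      rw [← Real.exp_nat_mul]
      norm_num
      have := Real.exp_one_lt_d9
      linarith
    exact lt_of_pow_lt_pow_left₀ 2 (by norm_num) h
  have he : Real.exp 1 = Real.exp (1 / 2) ^ 2 := by rw [← Real.exp_nat_mul]; norm_num
  have h5 : (2.2814 : ℝ) < 5 - Real.exp 1 := by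
    rw [he]
    nlinarith [ht', Real.exp_pos (1 / 2 : ℝ)]
  have h5e : 0 < 5 - Real.exp 1 := by linarith
  have hst : (1.77245 : ℝ) * 1.6487 < Real.sqrt Real.pi * Real.exp (1 / 2) :=
    mul_lt_mul'' hs ht (by norm_num) (by norm_num)
  have key : (6 : ℝ) < (5 - Real.exp 1) * (Real.sqrt Real.pi * Real.exp (1 / 2)) := by
    calc (6 : ℝ) < 2.2814 * (1.77245 * 1.6487) := by norm_num
      _ < (5 - Real.exp 1) * (Real.sqrt Real.pi * Real.exp (1 / 2)) :=
          mul_lt_mul'' h5 hst (by norm_num) (by norm_num)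
  -- `192π² < (5 − e)V`
  have hfin : 192 * Real.pi ^ 2 < 5 * V - Real.exp 1 * V := by
    have hp : 0 < 32 * Real.pi ^ 2 := by positivity
    have h1 : 32 * Real.pi ^ 2 * 6 <
        32 * Real.pi ^ 2 * ((5 - Real.exp 1) * (Real.sqrt Real.pi * Real.exp (1 / 2))) :=
      mul_lt_mul_of_pos_left key hp
    have h2 : (5 - Real.exp 1) * (32 * Real.pi ^ 2 * Real.sqrt Real.pi * Real.exp (1 / 2)) <
        (5 - Real.exp 1) * V :=
      mul_lt_mul_of_pos_left hV₀ h5e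
    have h3 : 32 * Real.pi ^ 2 * ((5 - Real.exp 1) * (Real.sqrt Real.pi * Real.exp (1 / 2))) =
        (5 - Real.exp 1) * (32 * Real.pi ^ 2 * Real.sqrt Real.pi * Real.exp (1 / 2)) := by ring
    have h4 : (5 - Real.exp 1) * V = 5 * V - Real.exp 1 * V := by ring
    linarith
  linarith [hD, h3Z, hfin]

/-- **The variance budget from the pointwise bound `f ≤ 3`** (Cheng–Ribeiro–Zhou route, per datum; the
homotopy type of `M` is not used): for a closed normalised gradient shrinker `Ric + Hess f = g/2`,
`R + |∇f|² = f`, of Gaussian mass `∫e^{-f} dV > 32π²√π e^{-3/2}`, with `f ≤ 3` everywhere,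
`∫(R − 2)² dV < 2·Vol − 96π²`. Chain of landed theorems: (B) `ΔR = g⁻¹(dR,df) + R − 2|Ric|²`
(`stub_shrinkerScalarIdentities`), trace Cauchy–Schwarz `R² ≤ 4|Ric|²` (`stub_scalarCurvature_sq_le`), the
defect identity `D = ∫(R − 2|Ric|²)(e^{3−f} − 1)` (`stub_variance_eq_integral_defect`), CRZ sharp
`D ≤ ½(e³Z − V)` (`stub_crzSharpBound_of_identities`), Jensen `Z ≤ e^{-2}V` (`stub_jensenVolumeBound`), and
`varianceBudget_arith`; the density is read as a Bochner integral (`e^{-f}` continuous on the compact `M`,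
whose Riemannian volume is finite, `riemannianVolume_lt_top_of_isCompact_holds`).
[cite: ChengRibeiroZhou2022, Thm. 1, §3.2 and Rem. 2] -/
theorem varianceBudget_of_potential_le_three
    (M : Type) [TopologicalSpace M] [T2Space M] [SecondCountableTopology M]
    [ChartedSpace (EuclideanSpace ℝ (Fin 4)) M] [IsManifold (𝓡 4) ∞ M] [CompactSpace M]
    [T3Space M] [MeasurableSpace M] [BorelSpace M]
    (g : Literature.Geometry.Lorentzian.PseudoRiemannianMetric (𝓡 4) ∞ (EuclideanSpace ℝ (Fin 4))
      (TangentSpace (𝓡 4) : M → Type _)) [g.HasLeviCivita] (f : M → ℝ) (hg : g.IsRiemannian)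
    (hf : ContMDiff (𝓡 4) 𝓘(ℝ, ℝ) ∞ f)
    (hsol : ∀ (x : M) (X Y : TangentSpace (𝓡 4) x),
      g.ricci x X Y + g.hessian f x X Y = (1 / 2 : ℝ) * g.val x X Y)
    (hnorm : ∀ x : M, g.scalarCurvature x + g.gradSq f x = f x)
    (hdens : ENNReal.ofReal (32 * Real.pi ^ 2 * Real.sqrt Real.pi * Real.exp (-(3 : ℝ) / 2)) <
        ∫⁻ x, ENNReal.ofReal (Real.exp (-f x)) ∂(riemannianMeasure (g.toContMDiffRiemannianMetric hg)))
    (hle3 : ∀ x : M, f x ≤ 3) :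
    ∫ x, (g.scalarCurvature x - 2) ^ 2 ∂(riemannianMeasure (g.toContMDiffRiemannianMetric hg)) <
      2 * ((riemannianMeasure (g.toContMDiffRiemannianMetric hg)) Set.univ).toReal - 96 * Real.pi ^ 2 := by
  -- the Riemannian measure of the closed manifold is finite; `e^{-f}` is continuous, so integrable
  haveI : IsFiniteMeasure (riemannianMeasure (g.toContMDiffRiemannianMetric hg)) :=
    ⟨riemannianVolume_lt_top_of_isCompact_holds (g.toContMDiffRiemannianMetric hg) le_rfl isCompact_univ⟩
  have hc : Continuous fun x ↦ Real.exp (-f x) := Real.continuous_exp.comp hf.continuous.neg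
  obtain ⟨C, hC⟩ := isCompact_univ.exists_bound_of_continuousOn hc.continuousOn
  have hint : Integrable (fun x ↦ Real.exp (-f x)) (riemannianMeasure (g.toContMDiffRiemannianMetric hg)) :=
    (memLp_top_of_bound hc.aestronglyMeasurable C (ae_of_all _ fun x ↦ hC x (mem_univ x))).integrable le_top
  -- (B), trace Cauchy–Schwarz, the defect identity at `c = 3`, CRZ sharp, Jensen
  obtain ⟨_, hB⟩ := stub_shrinkerScalarIdentities M g f hg hf hsol
  have hT := stub_scalarCurvature_sq_le M g hg
  have hI := stub_variance_eq_integral_defect M g f hg hf hsol hB 3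
  have hD := stub_crzSharpBound_of_identities M g f hg hf hT 3 hle3 hI
  have hJ := stub_jensenVolumeBound M g f hg hf hsol hnorm
  -- the density hypothesis as a real (Bochner) integral
  have hdens' := hdens
  rw [← ofReal_integral_eq_lintegral_ofReal hint (ae_of_all _ fun x ↦ (Real.exp_pos _).le),
    ENNReal.ofReal_lt_ofReal_iff'] at hdens'
  exact varianceBudget_arith hdens'.1 hJ hD

/-- **`sup f ≤ sup R` on a closed normalised shrinker (Fermat).** If `R ≤ c` everywhere then `f ≤ c`
everywhere; the only inputs are `R + |∇f|²_g = f` and continuity of `f` on the compact non-empty `M`: at a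
maximum point `x₀` of `f`, `df(x₀) = 0` (`IsLocalMax.isMCriticalPt`), so `|∇f|²(x₀) = 0` and
`f ≤ f(x₀) = R(x₀) ≤ c`. Adapted from the registered skeleton (v9) / `Disproof.lean` §19.
[cite: ChengRibeiroZhou2022, Rem. 1] -/
theorem forall_potential_le_of_forall_scalarCurvature_le
    {M : Type} [TopologicalSpace M] [ChartedSpace (EuclideanSpace ℝ (Fin 4)) M]
    [IsManifold (𝓡 4) ∞ M] [CompactSpace M] [Nonempty M]
    (g : Literature.Geometry.Lorentzian.PseudoRiemannianMetric (𝓡 4) ∞ (EuclideanSpace ℝ (Fin 4))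
      (TangentSpace (𝓡 4) : M → Type _)) [g.HasLeviCivita] (f : M → ℝ) (hf : Continuous f)
    (hnorm : ∀ x : M, g.scalarCurvature x + g.gradSq f x = f x) (c : ℝ)
    (hR : ∀ x : M, g.scalarCurvature x ≤ c) : ∀ x : M, f x ≤ c := by
  intro x
  obtain ⟨x₀, -, hmax⟩ := isCompact_univ.exists_isMaxOn univ_nonempty hf.continuousOn
  have hloc : IsLocalMax f x₀ := Filter.Eventually.of_forall fun y ↦ hmax (mem_univ y)
  have hcrit : mfderiv (𝓡 4) 𝓘(ℝ, ℝ) f x₀ = 0 :=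
    Literature.Topology.FourManifolds.IsLocalMax.isMCriticalPt hloc
  have hd : mvfderiv (𝓡 4) f x₀ = 0 := by
    ext v
    simp [mvfderiv, hcrit]
  have h0 : g.gradSq f x₀ = 0 := by
    simp [Literature.Geometry.Lorentzian.PseudoRiemannianMetric.gradSq, hd,
      Literature.Geometry.Lorentzian.PseudoRiemannianMetric.innerDual]
  have h1 : f x₀ = g.scalarCurvature x₀ := by
    have := hnorm x₀; rw [h0, add_zero] at this; exact this.symm
  calc f x ≤ f x₀ := hmax (mem_univ x)
    _ = g.scalarCurvature x₀ := h1
    _ ≤ c := hR x₀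

/-- **Item `CompactGapOfChangGurskyYang` from the pointwise bound `R ≤ 3` and Chern–Gauss–Bonnet.** If every
dense normalised gradient shrinker on a closed homotopy 4-sphere has `R ≤ 3` everywhere (hypothesis `hR3`,
verbatim the registered stub `stub_scalarLeThree` of line `cgy-variance-pivot` of crux
stmt-SmoothPoincare4-10870; `3 = 1.5 ×` the round value, method ceiling `3.0807`), then — given the CGB
formula `hCGB` — `ChangGurskyYang → CompactShrinkerGap`: `R ≤ 3 ⇒ f ≤ 3` (Fermat,
`forall_potential_le_of_forall_scalarCurvature_le`) `⇒ ∫(R − 2)² dV < 2·Vol − 96π²` (Cheng–Ribeiro–Zhou,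
`varianceBudget_of_potential_le_three`) `⇒` the item (`compactGapOfChangGurskyYang_of_varianceBudget`: CGB turns the
variance budget into the Weyl budget `∫|W|² < 32π²` and CGY returns `M ≃ₘ S⁴`). [cite: ChengRibeiroZhou2022, Thm. 1 and Rem. 1–2]
[cite: ChangGurskyYang2003, Thm. A and (1.1)] -/
theorem compactGapOfChangGurskyYang_of_scalarLeThree
    (hCGB : Literature.Geometry.Riemannian.chernGaussBonnet_four)
    (hR3 : ∀ (M : Type) [TopologicalSpace M] [T2Space M] [SecondCountableTopology M]
      [ChartedSpace (EuclideanSpace ℝ (Fin 4)) M] [IsManifold (𝓡 4) ∞ M] [CompactSpace M]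
      [T3Space M] [MeasurableSpace M] [BorelSpace M],
      M ≃ₕ Metric.sphere (0 : EuclideanSpace ℝ (Fin 5)) 1 →
    ∀ (g : Literature.Geometry.Lorentzian.PseudoRiemannianMetric (𝓡 4) ∞ (EuclideanSpace ℝ (Fin 4))
        (TangentSpace (𝓡 4) : M → Type _)) [g.HasLeviCivita] (f : M → ℝ) (hg : g.IsRiemannian),
      ContMDiff (𝓡 4) 𝓘(ℝ, ℝ) ∞ f →
      (∀ (x : M) (X Y : TangentSpace (𝓡 4) x),
        g.ricci x X Y + g.hessian f x X Y = (1 / 2 : ℝ) * g.val x X Y) →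
      (∀ x : M, g.scalarCurvature x + g.gradSq f x = f x) →
      ENNReal.ofReal (32 * Real.pi ^ 2 * Real.sqrt Real.pi * Real.exp (-(3 : ℝ) / 2)) <
        ∫⁻ x, ENNReal.ofReal (Real.exp (-f x))
          ∂(Literature.Geometry.Lorentzian.riemannianMeasure (g.toContMDiffRiemannianMetric hg)) →
      ∀ x : M, g.scalarCurvature x ≤ 3) :
    CompactGapOfChangGurskyYang :=
  compactGapOfChangGurskyYang_of_varianceBudget hCGB
    fun M _ _ _ _ _ _ _ _ _ e g _ f hg hf hsol hnorm hdens ↦ by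
      haveI : Nonempty M := ⟨e.symm ⟨EuclideanSpace.single 0 1, by simp⟩⟩
      exact varianceBudget_of_potential_le_three M g f hg hf hsol hnorm hdens
        (forall_potential_le_of_forall_scalarCurvature_le g f hf.continuous hnorm 3
          (hR3 M e g f hg hf hsol hnorm hdens))

end Summit.SmoothPoincare4.SmoothPoincare4.Theorems

end
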